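import Mathlib
import Summits.Ventures.PercRepro2.TypedRootVertex

/-!
# Two adjacent hats (blind cell PercRepro2, p2 g0, 2026-08-25; sub-claim S1, the hat class of
mine-1's MINE1-J1.md §23.11 — the adjacent-hats step)

Two hats `u`, `w` adjacent to each other (`e_v = u–w`, `e₁ = u–a₁`, `e₂ = u–a₂`, `f₁ = w–a₁`,
`f₂ = w–a₂`, nothing else typed at `u` or `w`): the hat rule at `u` re-maps `e_v` to `w–a₁` and
`e₁` to `w–a₂` — parallel to `f₁`, `f₂` — after which `w` has typed edges to the roots only; the
typed parallel rule (rule (b), `typedCount_parallel_st`) merges the parallels and the root vertex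
`w` factors out (`typedCount_rootVertex_st`). Every coefficient is nonnegative, and every base term
is a typed count of the instance with the five edges removed. Hence:

* **`nonneg_of_hatPair`** — if the typed counts of the instance without the five edges are `≥ 0`
  for every type map agreeing with `τ` there, the typed count of the instance is `≥ 0`.

Also `typedCount_congr_ends_st` (closed edges may be re-mapped freely) and
`nonneg_of_parallel_or_zero` (absorbing a parallel edge of type `0`, `1` or `2`). Own code;
standard axioms.
-/

namespace Summit.Ventures.PercRepro2

open UnionCluster

namespace CovForm

namespace TypedRed

open OneTyped

/-! ## Closed edges may be re-mapped -/

section Congr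

variable {V : Type*} {E : Type*} [DecidableEq E]

omit [DecidableEq E] in
/-- Connectivity depends on the ends of the open edges only. -/
lemma conn_congr_ends {ends ends' : E → Sym2 V} {x : Config E}
    (h : ∀ e, x e = true → ends e = ends' e) (p q : V) :
    Conn ends x p q ↔ Conn ends' x p q := by
  have hg : openGraph ends x = openGraph ends' x := by
    ext p q
    simp only [openGraph_adj, OpenAdj]
    constructor
    · rintro ⟨hpq, e, he, hends⟩
      exact ⟨hpq, e, he, by rw [← h e he]; exact hends⟩
    · rintro ⟨hpq, e, he, hends⟩
      exact ⟨hpq, e, he, by rw [h e he]; exact hends⟩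
  unfold Conn
  rw [hg]

variable (ends ends' : E → Sym2 V) (o a₁ a₂ a₃ b : V)

omit [DecidableEq E] in
/-- The state depends on the ends of the open edges only. -/
lemma st_congr_ends {x : Config E} (h : ∀ e, x e = true → ends e = ends' e) :
    st ends o a₁ a₂ a₃ b x = st ends' o a₁ a₂ a₃ b x := by
  unfold st
  simp only [Prod.mk.injEq]
  exact ⟨decide_eq_decide.mpr (conn_congr_ends h _ _), decide_eq_decide.mpr (conn_congr_ends h _ _),
    decide_eq_decide.mpr (conn_congr_ends h _ _), decide_eq_decide.mpr (conn_congr_ends h _ _),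
    decide_eq_decide.mpr (conn_congr_ends h _ _), decide_eq_decide.mpr (conn_congr_ends h _ _),
    decide_eq_decide.mpr (conn_congr_ends h _ _)⟩

variable [Fintype E] {R : Type*} [Field R] (KK : St → St → St → R)

/-- **Closed edges may be re-mapped**: two edge maps agreeing on the typed edges and on the
pinned-open edges give the same typed count. -/
theorem typedCount_congr_ends_st (F : Finset E) (z : Config E) (τ : E → ℕ)
    (h : ∀ e, e ∈ F ∨ z e = true → ends e = ends' e) :
    typedCount F z τ (stKer ends o a₁ a₂ a₃ b KK) =
      typedCount F z τ (stKer ends' o a₁ a₂ a₃ b KK) := by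
  refine typedCount_congr_K_on _ _ _ fun x y w hxyw _ => ?_
  have hx : ∀ e, x e = true → ends e = ends' e := fun e he => by
    by_cases heF : e ∈ F
    · exact h e (Or.inl heF)
    · exact h e (Or.inr ((hxyw e heF).1.symm.trans he))
  have hy : ∀ e, y e = true → ends e = ends' e := fun e he => by
    by_cases heF : e ∈ F
    · exact h e (Or.inl heF)
    · exact h e (Or.inr ((hxyw e heF).2.1.symm.trans he))
  have hw : ∀ e, w e = true → ends e = ends' e := fun e he => by
    by_cases heF : e ∈ F
    · exact h e (Or.inl heF)
    · exact h e (Or.inr ((hxyw e heF).2.2.symm.trans he))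
  unfold stKer
  rw [st_congr_ends ends ends' o a₁ a₂ a₃ b hx, st_congr_ends ends ends' o a₁ a₂ a₃ b hy,
    st_congr_ends ends ends' o a₁ a₂ a₃ b hw]

end Congr

/-! ## Absorbing a parallel edge of type `0`, `1` or `2` -/

section Parallel

variable {V : Type*} {E : Type*} [DecidableEq V] [Fintype E] [DecidableEq E]
variable {R : Type*} [Field R] [LinearOrder R] [IsStrictOrderedRing R]
variable (ends : E → Sym2 V) (o a₁ a₂ a₃ b : V) (KK : St → St → St → R)

omit [DecidableEq V] [Fintype E] in
/-- Pinning a closed edge closed changes nothing. -/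
lemma update_false_false (e : E) :
    Function.update (fun _ : E => false) e false = fun _ => false := by
  funext g
  simp only [Function.update_apply]
  split_ifs <;> rfl

omit [DecidableEq V] in
/-- If the counts with the parallel edge `f` absorbed into `e` (every type `j`) are nonnegative,
so is the count with `f` (type `0`, `1` or `2`). -/
theorem nonneg_of_parallel_or_zero {e f : E} (hef : e ≠ f) (hpar : ends e = ends f) (F : Finset E)
    (heF : e ∈ F) (hfF : f ∈ F) (τ : E → ℕ) (hτe : τ e = 1 ∨ τ e = 2)
    (hτf : τ f = 0 ∨ τ f = 1 ∨ τ f = 2)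
    (H : ∀ j : ℕ, 0 ≤ typedCount (F.erase f) (fun _ => false) (Function.update τ e j)
      (stKer ends o a₁ a₂ a₃ b KK)) :
    0 ≤ typedCount F (fun _ => false) τ (stKer ends o a₁ a₂ a₃ b KK) := by
  rcases hτf with h0 | h12
  · rw [typedCount_type_zero F f hfF _ τ h0, update_false_false]
    have := H (τ e)
    rwa [Function.update_eq_self] at this
  · rw [typedCount_parallel_st ends o a₁ a₂ a₃ b KK hef hpar F heF hfF _ τ hτe h12,
      update_false_false]
    exact Finset.sum_nonneg fun j _ => mul_nonneg (Nat.cast_nonneg _) (H j)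

end Parallel

/-! ## Two adjacent hats -/

section Pair

variable {V : Type*} {E : Type*} [DecidableEq V] [Fintype E] [DecidableEq E]
variable {R : Type*} [Field R] [LinearOrder R] [IsStrictOrderedRing R]
variable (ends : E → Sym2 V) (o a₁ a₂ a₃ b : V)

omit [DecidableEq V] [Fintype E] [DecidableEq E] in
/-- Two unordered pairs differ unless they match in one of the two orders. -/
lemma sym2_ne {p q r t : V} (h1 : ¬ (p = r ∧ q = t)) (h2 : ¬ (p = t ∧ q = r)) :
    s(p, q) ≠ s(r, t) := fun h => by
  rcases Sym2.eq_iff.1 h with h' | h'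
  · exact h1 h'
  · exact h2 h'

omit [DecidableEq V] in
/-- **Two adjacent hats factor out**: `u`, `w` unmarked, `e_v = u–w`, `e₁ = u–a₁`, `e₂ = u–a₂`,
`f₁ = w–a₁`, `f₂ = w–a₂` their typed edges (mixed types), nothing else typed at `u` or `w`. If the
typed counts of the instance without the five edges are nonnegative for every type map agreeing
with `τ` there, the typed count is nonnegative. -/
theorem nonneg_of_hatPair {u w : V} {e_v e₁ e₂ f₁ f₂ : E}
    (hv : ends e_v = s(u, w)) (h1 : ends e₁ = s(u, a₁)) (h2 : ends e₂ = s(u, a₂))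
    (hf1 : ends f₁ = s(w, a₁)) (hf2 : ends f₂ = s(w, a₂)) (h12 : a₁ ≠ a₂)
    (huw : u ≠ w) (huo : u ≠ o) (hu1 : u ≠ a₁) (hu2 : u ≠ a₂) (hu3 : u ≠ a₃) (hub : u ≠ b)
    (hwo : w ≠ o) (hw1 : w ≠ a₁) (hw2 : w ≠ a₂) (hw3 : w ≠ a₃) (hwb : w ≠ b)
    (F : Finset E) (hvF : e_v ∈ F) (h1F : e₁ ∈ F) (h2F : e₂ ∈ F) (hf1F : f₁ ∈ F) (hf2F : f₂ ∈ F)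
    (huonly : ∀ e ∈ F, u ∈ ends e → e = e_v ∨ e = e₁ ∨ e = e₂)
    (hwonly : ∀ e ∈ F, w ∈ ends e → e = e_v ∨ e = f₁ ∨ e = f₂)
    (τ : E → ℕ) (hτv : τ e_v = 1 ∨ τ e_v = 2) (hτ1 : τ e₁ = 1 ∨ τ e₁ = 2)
    (hτ2 : τ e₂ = 1 ∨ τ e₂ = 2) (hτf1 : τ f₁ = 1 ∨ τ f₁ = 2) (hτf2 : τ f₂ = 1 ∨ τ f₂ = 2)
    (H : ∀ σ : E → ℕ, (∀ e ∈ ((((F.erase e_v).erase e₁).erase e₂).erase f₁).erase f₂, σ e = τ e) →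
      0 ≤ typedCount (((((F.erase e_v).erase e₁).erase e₂).erase f₁).erase f₂) (fun _ => false) σ
        (K3 ends o a₁ a₂ a₃ b : Config E → Config E → Config E → R)) :
    0 ≤ typedCount F (fun _ => false) τ
      (K3 ends o a₁ a₂ a₃ b : Config E → Config E → Config E → R) := by
  -- the five edges are distinct
  have hev1 : e_v ≠ e₁ := fun h => sym2_ne (fun h' => hw1 h'.2) (fun h' => hu1 h'.1) (hv ▸ h1 ▸ congrArg ends h)
  have hev2 : e_v ≠ e₂ := fun h => sym2_ne (fun h' => hw2 h'.2) (fun h' => hu2 h'.1) (hv ▸ h2 ▸ congrArg ends h)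
  have he12 : e₁ ≠ e₂ := fun h => sym2_ne (fun h' => h12 h'.2) (fun h' => hu2 h'.1) (h1 ▸ h2 ▸ congrArg ends h)
  have hevf1 : e_v ≠ f₁ := fun h => sym2_ne (fun h' => huw h'.1) (fun h' => hu1 h'.1) (hv ▸ hf1 ▸ congrArg ends h)
  have hevf2 : e_v ≠ f₂ := fun h => sym2_ne (fun h' => huw h'.1) (fun h' => hu2 h'.1) (hv ▸ hf2 ▸ congrArg ends h)
  have he1f1 : e₁ ≠ f₁ := fun h => sym2_ne (fun h' => huw h'.1) (fun h' => hu1 h'.1) (h1 ▸ hf1 ▸ congrArg ends h)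
  have he1f2 : e₁ ≠ f₂ := fun h => sym2_ne (fun h' => huw h'.1) (fun h' => hu2 h'.1) (h1 ▸ hf2 ▸ congrArg ends h)
  have he2f1 : e₂ ≠ f₁ := fun h => sym2_ne (fun h' => huw h'.1) (fun h' => hu1 h'.1) (h2 ▸ hf1 ▸ congrArg ends h)
  have he2f2 : e₂ ≠ f₂ := fun h => sym2_ne (fun h' => huw h'.1) (fun h' => hu2 h'.1) (h2 ▸ hf2 ▸ congrArg ends h)
  have hf12 : f₁ ≠ f₂ := fun h => sym2_ne (fun h' => h12 h'.2) (fun h' => hw2 h'.1) (hf1 ▸ hf2 ▸ congrArg ends h)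
  set KB' : St → St → St → R := fun x y w => ((KB x y w : ℤ) : R) with hKB'
  have hq : ∀ x y w : St, x.q' = true ∨ y.q' = true ∨ w.q' = true → KB' x y w = 0 :=
    (ruleKernel_KB (R := R)).root_pair
  simp only [K3_eq_stKer] at H ⊢
  -- the hat rule at `u`
  have hcl : ∀ e, u ∈ ends e → e ≠ e_v → e ≠ e₁ → e ≠ e₂ →
      e ∉ F ∧ (fun _ : E => false) e = false := by
    intro e hue h₁ h₂ h₃
    refine ⟨fun heF => ?_, rfl⟩
    rcases huonly e heF hue with h | h | h
    · exact h₁ h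
    · exact h₂ h
    · exact h₃ h
  rw [typedCount_hat_st ends o a₁ a₂ a₃ b KB' hq hv h1 h2 hev1 hev2 he12 huo hu1 hu2 hu3 hub F hvF
    h1F h2F (fun _ => false) hcl τ hτv hτ1 hτ2, update_false_false]
  refine Finset.sum_nonneg fun t₁ ht₁ => Finset.sum_nonneg fun t₂ ht₂ =>
    mul_nonneg (Nat.cast_nonneg _) ?_
  set ends' := hatEnds ends e_v e₁ w a₁ a₂ with hends'
  have hends'_v : ends' e_v = s(w, a₁) := hatEnds_ev hev1
  have hends'_1 : ends' e₁ = s(w, a₂) := hatEnds_e1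
  have hends'_o : ∀ e, e ≠ e_v → e ≠ e₁ → ends' e = ends e := fun e h₁ h₂ => hatEnds_other h₁ h₂
  have ht₁' : t₁ = 0 ∨ t₁ = 1 ∨ t₁ = 2 := by
    have := Finset.mem_range.1 ht₁
    omega
  have ht₂' : t₂ = 0 ∨ t₂ = 1 ∨ t₂ = 2 := by
    have := Finset.mem_range.1 ht₂
    omega
  set τ' := Function.update (Function.update τ e_v t₁) e₁ t₂ with hτ'
  -- step A: `e_v` (now `w–a₁`) is absorbed into `f₁`
  refine nonneg_of_parallel_or_zero ends' o a₁ a₂ a₃ b KB' hevf1.symm (by rw [hends'_v, hends'_o f₁ hevf1.symm he1f1.symm, hf1])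
    (F.erase e₂) (Finset.mem_erase.2 ⟨he2f1.symm, hf1F⟩) (Finset.mem_erase.2 ⟨hev2, hvF⟩) τ'
    (by rw [hτ', Function.update_of_ne he1f1.symm, Function.update_of_ne hevf1.symm]; exact hτf1)
    (by rw [hτ', Function.update_of_ne hev1, Function.update_self]; exact ht₁') fun j => ?_
  -- step B: `e₁` (now `w–a₂`) is absorbed into `f₂`
  refine nonneg_of_parallel_or_zero ends' o a₁ a₂ a₃ b KB' he1f2.symm (by rw [hends'_1, hends'_o f₂ hevf2.symm he1f2.symm, hf2])
    ((F.erase e₂).erase e_v) (Finset.mem_erase.2 ⟨hevf2.symm, Finset.mem_erase.2 ⟨he2f2.symm, hf2F⟩⟩)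
    (Finset.mem_erase.2 ⟨hev1.symm, Finset.mem_erase.2 ⟨he12, h1F⟩⟩) _
    (by rw [Function.update_of_ne hf12.symm, hτ', Function.update_of_ne he1f2.symm,
      Function.update_of_ne hevf2.symm]; exact hτf2)
    (by rw [Function.update_of_ne he1f1, hτ', Function.update_self]; exact ht₂') fun j' => ?_
  -- step C: `w` is a root vertex
  have hclw : ∀ e, w ∈ ends' e → e ≠ f₁ → e ≠ f₂ →
      e ∉ ((F.erase e₂).erase e_v).erase e₁ ∧ (fun _ : E => false) e = false := by
    intro e hwe h₁ h₂
    refine ⟨fun heF => ?_, rfl⟩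
    have he1 : e ≠ e₁ := (Finset.mem_erase.1 heF).1
    have hev : e ≠ e_v := (Finset.mem_erase.1 (Finset.mem_erase.1 heF).2).1
    have he2 : e ≠ e₂ := (Finset.mem_erase.1 (Finset.mem_erase.1 (Finset.mem_erase.1 heF).2).2).1
    rw [hends'_o e hev he1] at hwe
    rcases hwonly e (Finset.mem_of_mem_erase (Finset.mem_of_mem_erase (Finset.mem_of_mem_erase heF)))
      hwe with h | h | h
    · exact hev h
    · exact h₁ h
    · exact h₂ h
  obtain ⟨c, hc, hEq⟩ := typedCount_rootVertex_st ends' o a₁ a₂ a₃ b KB' hq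
    (by rw [hends'_o f₁ hevf1.symm he1f1.symm]; exact hf1)
    (by rw [hends'_o f₂ hevf2.symm he1f2.symm]; exact hf2) hf12 hwo hw1 hw2 hw3 hwb
    (((F.erase e₂).erase e_v).erase e₁)
    (Finset.mem_erase.2 ⟨he1f1.symm, Finset.mem_erase.2 ⟨hevf1.symm, Finset.mem_erase.2 ⟨he2f1.symm, hf1F⟩⟩⟩)
    (Finset.mem_erase.2 ⟨he1f2.symm, Finset.mem_erase.2 ⟨hevf2.symm, Finset.mem_erase.2 ⟨he2f2.symm, hf2F⟩⟩⟩)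
    (fun _ => false) hclw _
  rw [hEq, update_false_false, update_false_false]
  refine mul_nonneg hc ?_
  -- step D: the base instance
  have hF5 : ((((F.erase e₂).erase e_v).erase e₁).erase f₁).erase f₂ =
      ((((F.erase e_v).erase e₁).erase e₂).erase f₁).erase f₂ := by
    ext e
    simp only [Finset.mem_erase]
    constructor
    · rintro ⟨h1, h2, h3, h4, h5, h6⟩
      exact ⟨h1, h2, h5, h3, h4, h6⟩
    · rintro ⟨h1, h2, h3, h4, h5, h6⟩
      exact ⟨h1, h2, h4, h5, h3, h6⟩
  rw [hF5, typedCount_congr_ends_st ends' ends o a₁ a₂ a₃ b KB' _ _ _ (fun e he => ?_)]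
  · refine H _ fun e he => ?_
    have hf2e : e ≠ f₂ := (Finset.mem_erase.1 he).1
    have hf1e : e ≠ f₁ := (Finset.mem_erase.1 (Finset.mem_erase.1 he).2).1
    have he2 : e ≠ e₂ := (Finset.mem_erase.1 (Finset.mem_erase.1 (Finset.mem_erase.1 he).2).2).1
    have he1 : e ≠ e₁ :=
      (Finset.mem_erase.1 (Finset.mem_erase.1 (Finset.mem_erase.1 (Finset.mem_erase.1 he).2).2).2).1
    have hev : e ≠ e_v := (Finset.mem_erase.1 (Finset.mem_erase.1 (Finset.mem_erase.1
      (Finset.mem_erase.1 (Finset.mem_erase.1 he).2).2).2).2).1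
    rw [Function.update_of_ne hf2e, Function.update_of_ne hf1e, hτ', Function.update_of_ne he1,
      Function.update_of_ne hev]
  · rcases he with he | he
    · have he1 : e ≠ e₁ :=
        (Finset.mem_erase.1 (Finset.mem_erase.1 (Finset.mem_erase.1 (Finset.mem_erase.1 he).2).2).2).1
      have hev : e ≠ e_v := (Finset.mem_erase.1 (Finset.mem_erase.1 (Finset.mem_erase.1
        (Finset.mem_erase.1 (Finset.mem_erase.1 he).2).2).2).2).1
      exact hends'_o e hev he1
    · exact absurd he Bool.false_ne_true

end Pair

end TypedRed

end CovForm

end Summit.Ventures.PercRepro2
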